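import Summits.ResolutionOfSingularities.ResolutionOfSingularities.Theorems.EquisingularLiftEquisingularLiftNatFreshPlaneProj
import Summits.ResolutionOfSingularities.ResolutionOfSingularities.Theorems.EquisingularLiftEquisingularLiftNatTangentConeChart
import HarnessLib

/-!
# [OURS · L1 W4.5(b) · EL♮(3) · (T-C) TANGENT-CONE DOOR, part 2] A TANGENT-CONE-ADAPTED FRESH-PLANE ISOMORPHISM:
# there is `e₀ : ℙⁿ_k ≅ Ẽ_x` under which the strict transform of `V(f) ∋ x` meets the fresh plane inside `V₊(in f)`

Cell `res-hironaka`, LADDER-RESOLUTION rung L (D-0089), slot W4.5(b), crux chain w45b: child crux **EL♮(3)** = stmt-ResolutionOfSingularities-20148.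
WIDTH seat res-L1-w45b-iso-w4 g2 (D-0157 DOOR 1); desk booking «(T-C) TANGENT-CONE DOOR» (res-L1-w45b-plan-1 g23, STATUS 2026-08-28T20:15:45Z).
`--supports stmt-ResolutionOfSingularities-20148 --as helper`.  OURS; NOT a statement of H. Hironaka's 2017 manuscript (nothing of [Hironaka2017] is
asserted); AI-written, and AI review is weaker than expert review.  DEF-FREE; no `sorry`; standard axioms.  EL♮(3) is NOT proved here; resolution of
singularities in positive characteristic is NOT proved here (dimension 3 is Cossart–Piltant 2008/2009 in print); counted 0 toward the summit.

WHAT.  The NEST step of the A⁵ prefix reach (`TowerNestB₅`, ✓ `…NatTowerNestDefs`) blows up an irreducible regular curve `Z` inside the FRESH PLANE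
`E' = υ⁻¹{x}` of a point step `υ` and carries the clause `DirStepUnobs G' E' _ Z _`; res-L1-w45b-iso-w2's doors (✓ `exists_iso_proj_redSub_preimage_singleton`,
✓ `dirStepUnobs_freshPlane_of_forall_model`, this seat's ✓ `dirStepUnobs_freshPlane_of_one_model`) reduce the clause to a MODEL statement about
`e⁻¹(Z) ⊆ ℙⁿ` for a plane isomorphism `e : ℙⁿ ≅ Ẽ_x := redSub G' (υ⁻¹{x})` — but the isomorphism they provide is abstract, so a customer holding an
explicit curve (`Z ⊆ E' ∩` strict transform of a surface `V(f)`, e.g. S10's tangent conic `Γ_q`) could not name `e⁻¹(Z)`.  This file supplies an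
isomorphism ADAPTED TO THE TANGENT CONE computed from the user's coordinates (EXISTENCE form `∃ k θ e₀`: WHICH isomorphism is not pinned beyond the
stated property — enough for the NEST clause, which is intrinsic to `(G', E', Z)` and is served by ANY one plane isomorphism carrying a model certificate,
✓ `dirStepUnobs_freshPlane_of_one_model`; the pinned, chart-by-chart form is part 1's affine theorem ✓ `mem_zeroLocus_of_mem_closure_strictTransform`):
* ★★ `TangentCone.exists_iso_freshPlane_tangentCone` — **(T-C)**: `x` a closed point, `υ` a blow-up of `𝓘_{x}`, `V ∋ x` an affine open with sections
  `t₀,…,tₙ ∈ Γ(G, V)` generating `𝓘_{x}(V)` and quasi-regular (a regular system of parameters at a regular point does: Literature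
  `isQuasiRegular_of_regularSeq` / `exists_isQuasiRegular_away_of_isRegularLocalRing_atMaximal_card`), `f ∈ Γ(G, V)` with `f ≡ P(t) mod (t)^{m+1}` for a
  USER-SUPPLIED form `P ∈ Γ(G,V)[T₀,…,Tₙ]` of degree `m > 0` (an initial form of `f`), and `T ⊆ G` any set with `f = 0` on `T ∩ V`.  THEN there are a
  field `k` (it is `κ(x)`: `k = Γ` of the reduced point, with a SURJECTION `θ : Γ(G, V) → k` killing the `t_l`) and an isomorphism
  `e₀ : ℙⁿ_k = Proj k[T₀,…,Tₙ] ≅ redSub G' (υ⁻¹{x})` such that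
  `e₀⁻¹ (redSubι⁻¹ (closure (υ⁻¹(T ∖ {x})))) ⊆ V₊(P^θ)` — the strict transform of `T` meets the fresh plane inside the projectivised tangent cone;
* `TangentCone.preimage_subset_zeroLocus_of_nest` — the same for any `Z ⊆ υ⁻¹{x} ∩ closure (υ⁻¹(T ∖ {x}))` (verbatim the NEST hypothesis shape
  `Z ⊆ E' ∩ closure (υ₂ ⁻¹' (T \ {y}))` of `TowerNestB₅`): `e₀⁻¹(redSubι⁻¹ Z) ⊆ V₊(P^θ)`.
CUSTOMER RECIPE (S10 at `q`, lead-1's memo §5): `t` = the three coordinates at `q`, `f` = the local equation of the running surface, `P` = its tangent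
quadric (`= (X₀X₁+X₂²)∘B`), `Z = Γ_q`-curve; (T-C) gives `e₀⁻¹(redSubι⁻¹ Z) ⊆ V₊((X₀X₁+X₂²)∘B)` over `k`; upgrade `⊆` to `=` (irreducible conic vs. a curve —
the customer's step, NOT done here), then ✓ `S10Conic.dirStepUnobs_conic_linearChange k B` + ✓ `dirStepUnobs_freshPlane_of_one_model` give the NEST clause.

PROOF.  Restrict `υ` over `V` (`IsBlowup.restrict`), move the data to `Γ(↑V, ⊤)` along `V.topIso`, apply part 1's affine form
✓ `TangentCone.mem_zeroLocus_of_mem_closure_strictTransform` (itself on Literature ✓ `exists_iso_pullback_proj_charts`, Hartshorne II 8.24 (b) with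
pinned charts) to the scheme-theoretic fibre `E = (υ|_V) ×_V B`, `B = V(𝓘_{x}|_V)` the reduced point, and identify `E` — reduced, a closed subscheme of `G'`
with support `υ⁻¹{x}` — with `redSub G' (υ⁻¹{x})` by uniqueness of the reduced structure (Literature ✓ `exists_iso_of_isClosedImmersion_of_range_eq`),
exactly as in res-L1-w45b-iso-w2's ✓ `exists_iso_proj_redSub_preimage_singleton` (imported BY NAME from `…NatFreshPlaneProj`; its statement is not
restated: the present theorem has different hypotheses — explicit coordinates instead of `𝒪_{G,x}` regular — and a stronger, coordinate-aware conclusion).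
The closure is moved into the open `υ⁻¹(V)` by `IsOpenMap.preimage_closure_eq_closure_preimage`.

HONEST SCOPE / DEGENERATE CHECKS.  Set-level `⊆` only (the reverse inclusion for the hypersurface `T = V(f)` with `P^θ ≠ 0` needs a dimension count on
the strict transform and is NOT proved here); EXISTENCE of `e₀` only (since `Aut(ℙⁿ_k) ⊇ PGL_{n+1}(k)` moves `V₊(P^θ)`, the `∃ e₀` form says the trace lies
in a subset projectively equivalent to `V₊(P^θ)` under the delivered `e₀` — which is what a NEST customer consumes; the PINNED statement is part 1's);
`P^θ = 0` ⇒ vacuous; `m = 0` excluded; `m = 1` ⇒ the hyperplane case (trace inside a hyperplane), the set shadow of res-D-pv-027's scheme-level (F⁺5)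
✓ `comap_strictTransformIdeal_eq_of_model` (cited, not restated); `n = 0` ⇒ `ℙ⁰_k` a point, consistent; no regularity of `G` away
from the data is used, and none of `𝒪_{G,x}` beyond what quasi-regularity of `t` encodes.  The field `k` is delivered as a `Type` with a `Field` instance
(`IsField.toField` of `Γ(B, 𝒪)`), so that `Field`-typed model certificates apply to `Proj k[T]` verbatim.

References (index only): R. Hartshorne, *Algebraic Geometry* (1977), II Thm. 8.24 (b), II §7 [cite: Hartshorne1977]; V. Cossart, O. Piltant,
J. Algebra 320 (2008), proof of Prop. 4.2 [cite: CossartPiltant2008]; The Stacks Project, Tag 0804 [cite: StacksProject].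
-/

set_option linter.dupNamespace false

noncomputable section

set_option backward.isDefEq.respectTransparency false

open CategoryTheory CategoryTheory.Limits AlgebraicGeometry TopologicalSpace Opposite MvPolynomial
open HomogeneousLocalization
open Literature.AlgebraicGeometry.Motives Literature.AlgebraicGeometry.Motives.Segre
open Literature.AlgebraicGeometry.Resolution
open AlgebraicGeometry.Scheme.IdealSheafData (vanishingIdeal)

attribute [local instance] MvPolynomial.gradedAlgebra ProjBaseChange.algebraBase

namespace Summit.ResolutionOfSingularities.ResolutionOfSingularities.Cruxes.EquisingularLiftNat.Sections

namespace TangentCone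

/-- The restriction `Γ(G, V) → Γ(V, ⊤)` to the top open of the open subscheme `V` is the inverse of `V.topIso`. [folklore] -/
theorem presheaf_map_eq_topIso_inv {G : Scheme.{0}} (V : G.Opens) (hle : V.ι ''ᵁ ⊤ ≤ V) :
    G.presheaf.map (homOfLE hle).op = V.topIso.inv := by
  rw [Scheme.Opens.topIso_inv]
  exact congrArg (fun h => G.presheaf.map (Quiver.Hom.op h)) (Subsingleton.elim _ _)

/-- ★★ **(T-C) THE TANGENT-CONE DOOR — a tangent-cone-adapted fresh-plane isomorphism (existence).**  `x ∈ G` closed, `υ : G' → G` a blow-up of `𝓘_{x}`,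
`V ∋ x` affine with `t₀,…,tₙ ∈ Γ(G, V)` generating `𝓘_{x}(V)` and quasi-regular, `f ∈ Γ(G, V)` with `f − P(t) ∈ (t)^{m+1}` for a form `P` of degree
`m > 0`, `T ⊆ G` with `f = 0` on `T ∩ V`.  Then there are a field `k`, a surjection `θ : Γ(G, V) → k` with `θ(t_l) = 0`, and an isomorphism
`e₀ : Proj k[T₀,…,Tₙ] ≅ redSub G' (υ⁻¹{x})` with `e₀⁻¹(redSubι⁻¹(closure (υ⁻¹(T ∖ {x})))) ⊆ V₊(P^θ)`: the strict transform of `T` meets the fresh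
plane inside the projectivised tangent cone of `f`.  Set-level `⊆` only; `∃ e₀` (the isomorphism is not pinned beyond this property; the pinned chart
form is part 1's `mem_zeroLocus_of_mem_closure_strictTransform`). [OURS · L1 W4.5b · EL♮(3) · (T-C); NOT a statement of the manuscript]
[cite: Hartshorne1977, II Thm. 8.24 (b)] [cite: CossartPiltant2008, proof of Prop. 4.2, (10)–(11)] -/
theorem exists_iso_freshPlane_tangentCone {G G' : Scheme.{0}} {x : G} (hx : IsClosed ({x} : Set G))
    {υ : G' ⟶ G} (hυ : IsBlowup υ (vanishingIdeal ⟨{x}, hx⟩))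
    (V : G.affineOpens) (hxV : x ∈ (V : G.Opens))
    {n : ℕ} (t : Fin (n + 1) → Γ(G, V)) (ht : Ideal.span (Set.range t) = (vanishingIdeal ⟨{x}, hx⟩).ideal V)
    (hqr : IsQuasiRegular t)
    (f : Γ(G, V)) {m : ℕ} (hm : 0 < m) (P : MvPolynomial (Fin (n + 1)) Γ(G, V)) (hP : P.IsHomogeneous m)
    (hfP : f - MvPolynomial.eval t P ∈ Ideal.span (Set.range t) ^ (m + 1))
    (T : Set G) (hT : ∀ y ∈ T, y ∈ (V : G.Opens) → y ∉ G.basicOpen f) :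
    ∃ (k : Type) (_ : Field k) (θ : Γ(G, V) →+* k) (_ : Function.Surjective θ) (_ : ∀ l, θ (t l) = 0)
      (e₀ : Proj (grading (Fin (n + 1)) k) ≅ redSub G' (υ ⁻¹' {x}) (hx.preimage υ.continuous)),
      (e₀.hom : _ → redSub G' (υ ⁻¹' {x}) (hx.preimage υ.continuous)) ⁻¹'
          ((redSubι G' (υ ⁻¹' {x}) (hx.preimage υ.continuous)) ⁻¹' closure (υ ⁻¹' (T \ {x}))) ⊆
        ProjectiveSpectrum.zeroLocus (grading (Fin (n + 1)) k) {MvPolynomial.map θ P} := by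
  classical
  obtain ⟨V, hV⟩ := V
  set J : G.IdealSheafData := vanishingIdeal ⟨{x}, hx⟩ with hJ
  set i₀ : (J.comap V.ι).subscheme ⟶ (V : Scheme.{0}) := (J.comap V.ι).subschemeι with hi₀
  haveI : IsAffine (V : Scheme.{0}) := hV
  -- the prime of `x` in `Γ(G, V)` is maximal and is the ideal of `J`
  obtain ⟨y, rfl⟩ : ∃ y : V, (y : G) = x := ⟨⟨x, hxV⟩, rfl⟩
  set 𝔭 := hV.primeIdealOf y with h𝔭
  haveI h𝔭max : 𝔭.asIdeal.IsMaximal := by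
    have hcl := hx.preimage hV.fromSpec.continuous
    rw [fromSpec_preimage_singleton hV y.2] at hcl
    exact (PrimeSpectrum.isClosed_singleton_iff_isMaximal _).mp hcl
  have hI𝔭 : J.ideal ⟨V, hV⟩ = 𝔭.asIdeal := by rw [hJ, h𝔭]; exact vanishingIdeal_singleton_ideal hV hx y.2
  -- sections over `V` as global sections of the open subscheme `↑V`
  have hle : V.ι ''ᵁ ⊤ ≤ V := by rw [Scheme.Opens.ι_image_top]
  set ρ : Γ(G, V) ⟶ Γ((V : Scheme.{0}), ⊤) := G.presheaf.map (homOfLE hle).op with hρ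
  have hρ' : ρ = V.topIso.inv := presheaf_map_eq_topIso_inv V hle
  let eρ : Γ(G, V) ≃+* Γ((V : Scheme.{0}), ⊤) := V.topIso.symm.commRingCatIsoToRingEquiv
  have heρ : ∀ a, eρ a = ρ a := fun a => by rw [hρ']; rfl
  have hρe : (⇑ρ.hom : Γ(G, V) → _) = ⇑eρ := funext fun a => (heρ a).symm
  -- the data on `M = ↑V`
  set x' : Fin (n + 1) → Γ((V : Scheme.{0}), ⊤) := fun l => ρ (t l) with hx'
  have hqr' : IsQuasiRegular x' := by
    have : x' = eρ ∘ t := funext fun l => (heρ (t l)).symm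
    rw [this]; exact hqr.map_ringEquiv eρ
  have hP' : (MvPolynomial.map ρ.hom P).IsHomogeneous m := hP.map _
  have hfP' : ρ f - MvPolynomial.eval x' (MvPolynomial.map ρ.hom P) ∈ Ideal.span (Set.range x') ^ (m + 1) := by
    have h1 : ρ (f - MvPolynomial.eval t P) ∈ Ideal.map ρ.hom (Ideal.span (Set.range t) ^ (m + 1)) := Ideal.mem_map_of_mem _ hfP
    rw [Ideal.map_pow, Ideal.map_span, ← Set.range_comp] at h1
    have h2 : ρ (f - MvPolynomial.eval t P) = ρ f - MvPolynomial.eval x' (MvPolynomial.map ρ.hom P) := by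
      rw [map_sub, MvPolynomial.eval_map, show MvPolynomial.eval t P = eval₂ (RingHom.id _) t P from rfl,
        show (ρ : Γ(G, V) → _) (eval₂ (RingHom.id _) t P) = ρ.hom (eval₂ (RingHom.id _) t P) from rfl,
        eval₂_comp_left, RingHom.comp_id]
      rfl
    rw [h2] at h1
    exact h1
  -- the blow-up restricted over `V` is a blow-up of `↑V` along `ker i₀ = J|_V`
  have hβ : IsBlowup (υ ∣_ V) i₀.ker := by
    rw [hi₀, Scheme.IdealSheafData.ker_subschemeι]; exact hυ.restrict V
  have hgen : Ideal.span (Set.range x') = i₀.ker.ideal ⟨⊤, isAffineOpen_top _⟩ := by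
    rw [hi₀, Scheme.IdealSheafData.ker_subschemeι, Scheme.IdealSheafData.ideal_comap_of_isOpenImmersion, Scheme.Opens.ι_appIso,
      Iso.refl_inv]
    have hWV : J.ideal ⟨V.ι ''ᵁ ⊤, (isAffineOpen_top (V : Scheme.{0})).image_of_isOpenImmersion V.ι⟩ =
        (J.ideal ⟨V, hV⟩).map ρ.hom := (J.map_ideal (U := ⟨V.ι ''ᵁ ⊤, _⟩) (V := ⟨V, hV⟩) hle).symm
    rw [hWV, ← ht, Ideal.map_span, ← Set.range_comp]
    change _ = (Ideal.span (Set.range (ρ.hom ∘ t))).comap (RingHom.id _)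
    rw [Ideal.comap_id]
    rfl
  have hsupp' : ((J.comap V.ι).support : Set (V : Scheme.{0})) = ⇑V.ι ⁻¹' {(y : G)} := by
    rw [Scheme.IdealSheafData.support_comap, TopologicalSpace.Closeds.coe_preimage, hJ,
      Scheme.IdealSheafData.coe_support_vanishingIdeal]
    rfl
  have hsupp : (i₀.ker.support : Set (V : Scheme.{0})) = ⇑V.ι ⁻¹' {(y : G)} := by
    rw [hi₀, Scheme.IdealSheafData.ker_subschemeι]; exact hsupp'
  -- the set `T` seen in `↑V`; `f` vanishes on it
  set T' : Set (V : Scheme.{0}) := ⇑V.ι ⁻¹' T with hT'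
  have hTf : ∀ z ∈ T', z ∉ (V : Scheme.{0}).basicOpen (ρ f) := by
    intro z hz hzf
    have h1 : V.ι z ∈ V.ι ''ᵁ (V : Scheme.{0}).basicOpen (V.topIso.inv f) := by
      rw [← hρ']; exact ⟨z, hzf, rfl⟩
    rw [Scheme.Opens.ι_image_basicOpen_topIso_inv] at h1
    exact hT _ hz z.2 h1
  -- (T-C), AFFINE FORM, on `↑V`
  obtain ⟨φ, -, -, hφ⟩ :=
    mem_zeroLocus_of_mem_closure_strictTransform hβ x' hgen hqr' (ρ f) hm (MvPolynomial.map ρ.hom P) hP' hfP' T' hTf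
  -- the base ring `R = Γ(B, 𝒪) ≅ Γ(G, V)/𝔭` is a field
  have hsurjB : Function.Surjective (i₀.appTop).hom := i₀.app_surjective ⊤ (isAffineOpen_top _)
  have hkerB : RingHom.ker (i₀.appTop).hom = 𝔭.asIdeal.map ρ.hom := by
    rw [← Scheme.Hom.ker_apply i₀ ⟨⊤, isAffineOpen_top _⟩, ← hgen, ← hI𝔭, ← ht, Ideal.map_span, ← Set.range_comp]
    rfl
  have hfieldB : IsField (Γ((J.comap V.ι).subscheme, ⊤) : Type) := by
    have hmapeq : 𝔭.asIdeal.map ρ.hom = 𝔭.asIdeal.map eρ := by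
      unfold Ideal.map; rw [hρe]
    have hmax : (𝔭.asIdeal.map ρ.hom).IsMaximal := by rw [hmapeq]; exact Ideal.map_isMaximal_of_equiv eρ
    have hq : IsField (Γ((V : Scheme.{0}), ⊤) ⧸ 𝔭.asIdeal.map ρ.hom) :=
      (Ideal.Quotient.maximal_ideal_iff_isField_quotient _).mp hmax
    exact MulEquiv.isField hq
      (((RingHom.quotientKerEquivOfSurjective hsurjB).symm.trans (Ideal.quotEquivOfEq hkerB)).toMulEquiv)
  -- the fibre is reduced and is a closed subscheme of `G'` with support `υ⁻¹{x}` (as in iso-w2's `exists_iso_proj_redSub_preimage_singleton`)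
  haveI : IsDomain (Γ((J.comap V.ι).subscheme, ⊤) : Type) := hfieldB.isDomain
  haveI : IsReduced (Proj (grading (Fin (n + 1)) (Γ((J.comap V.ι).subscheme, ⊤) : Type))) := Proj.isReduced _
  haveI : IsReduced (pullback (υ ∣_ V) i₀) := isReduced_of_isOpenImmersion φ.hom
  set c : pullback (υ ∣_ V) i₀ ⟶ G' := pullback.fst (υ ∣_ V) i₀ ≫ (υ ⁻¹ᵁ V).ι with hc
  have hrange : Set.range c = υ ⁻¹' {(y : G)} := by
    rw [hc, Scheme.Hom.comp_base, TopCat.coe_comp, Set.range_comp, Scheme.Pullback.range_fst, hi₀,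
      Scheme.IdealSheafData.range_subschemeι, hsupp']
    ext y'
    constructor
    · rintro ⟨z, hz, rfl⟩
      have hz' : V.ι ((υ ∣_ V) z) ∈ ({(y : G)} : Set G) := hz
      rw [← Scheme.Hom.comp_apply, morphismRestrict_ι, Scheme.Hom.comp_apply] at hz'
      exact hz'
    · intro hy'
      have hxV : υ y' ∈ V := by rw [show υ y' = (y : G) from hy']; exact y.2
      refine ⟨⟨y', hxV⟩, ?_, rfl⟩
      change V.ι ((υ ∣_ V) ⟨y', hxV⟩) ∈ ({(y : G)} : Set G)
      rw [← Scheme.Hom.comp_apply, morphismRestrict_ι, Scheme.Hom.comp_apply]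
      exact hy'
  haveI : IsClosedImmersion c := by
    refine IsClosedImmersion.of_isPreimmersion c ?_
    rw [hrange]; exact hx.preimage υ.continuous
  haveI : IsReduced (redSub G' (υ ⁻¹' {(y : G)}) (hx.preimage υ.continuous)) := isReduced_redSub G' _ _
  obtain ⟨e', he'⟩ := Literature.AlgebraicGeometry.Motives.exists_iso_of_isClosedImmersion_of_range_eq
    (redSubι G' (υ ⁻¹' {(y : G)}) (hx.preimage υ.continuous)) c
    (by rw [hrange, Scheme.IdealSheafData.range_subschemeι, Scheme.IdealSheafData.coe_support_vanishingIdeal]; rfl)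
  -- the field `k := Γ(B, 𝒪)` and `θ := i₀^* ∘ ρ`
  letI : Field (Γ((J.comap V.ι).subscheme, ⊤) : Type) := hfieldB.toField
  refine ⟨Γ((J.comap V.ι).subscheme, ⊤), inferInstance, (i₀.appTop).hom.comp ρ.hom, ?_, ?_, φ.symm ≪≫ e', ?_⟩
  · -- `θ` is surjective
    have hρsurj : Function.Surjective (⇑ρ.hom : Γ(G, V) → _) := by rw [hρe]; exact eρ.surjective
    exact hsurjB.comp hρsurj
  · -- `θ (t_l) = 0`
    intro l
    have h1 : x' l ∈ RingHom.ker (i₀.appTop).hom := by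
      rw [← Scheme.Hom.ker_apply i₀ ⟨⊤, isAffineOpen_top _⟩, ← hgen]
      exact Ideal.subset_span ⟨l, rfl⟩
    exact h1
  · -- the tangent-cone inclusion
    intro p hp
    rw [Set.mem_preimage, Set.mem_preimage] at hp
    -- `q = φ⁻¹ p ∈ E`, `z = pr₁ q ∈ υ⁻¹(V)`
    have hq : redSubι G' (υ ⁻¹' {(y : G)}) (hx.preimage υ.continuous) ((φ.symm ≪≫ e').hom p) = c (φ.inv p) := by
      rw [Iso.trans_hom, Iso.symm_hom, Scheme.Hom.comp_apply, ← Scheme.Hom.comp_apply _ (redSubι _ _ _), he']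
    rw [hq, hc, Scheme.Hom.comp_apply] at hp
    -- closure inside the open subscheme `υ⁻¹(V)`
    have hopen : IsOpenMap (υ ⁻¹ᵁ V).ι := (υ ⁻¹ᵁ V).ι.isOpenEmbedding.isOpenMap
    have hz : (pullback.fst (υ ∣_ V) i₀) (φ.inv p) ∈ closure (⇑(υ ⁻¹ᵁ V).ι ⁻¹' (υ ⁻¹' (T \ {(y : G)}))) := by
      rw [← hopen.preimage_closure_eq_closure_preimage (υ ⁻¹ᵁ V).ι.continuous]; exact hp
    have hset : ⇑(υ ⁻¹ᵁ V).ι ⁻¹' (υ ⁻¹' (T \ {(y : G)})) = ⇑(υ ∣_ V) ⁻¹' (T' \ (i₀.ker.support : Set (V : Scheme.{0}))) := by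
      rw [hsupp, hT']
      ext z
      simp only [Set.mem_preimage, Set.mem_sdiff, Set.mem_singleton_iff]
      rw [← Scheme.Hom.comp_apply, ← morphismRestrict_ι, Scheme.Hom.comp_apply]
    rw [hset] at hz
    have key := hφ (φ.inv p) hz
    have e2 : (φ.hom : _ → Proj (grading (Fin (n + 1)) (Γ((J.comap V.ι).subscheme, ⊤) : Type))) (φ.inv p) = p := by
      rw [← Scheme.Hom.comp_apply, Iso.inv_hom_id]; rfl
    rw [e2, MvPolynomial.map_map] at key
    exact key

/-- **(T-C) in the NEST hypothesis shape**: for every `Z ⊆ υ⁻¹{x} ∩ closure (υ⁻¹(T ∖ {x}))` (verbatim the shape `Z ⊆ E' ∩ closure (υ₂ ⁻¹' (T \ {y}))`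
of `TowerNestB₅`), `e₀⁻¹(redSubι⁻¹ Z) ⊆ V₊(P^θ)` for the field `k`, surjection `θ` and isomorphism `e₀` of `exists_iso_freshPlane_tangentCone`.
[OURS · L1 W4.5b · EL♮(3) · (T-C); NOT a statement of the manuscript] -/
theorem preimage_subset_zeroLocus_of_nest {G G' : Scheme.{0}} {x : G} (hx : IsClosed ({x} : Set G))
    {υ : G' ⟶ G} (hυ : IsBlowup υ (vanishingIdeal ⟨{x}, hx⟩))
    (V : G.affineOpens) (hxV : x ∈ (V : G.Opens))
    {n : ℕ} (t : Fin (n + 1) → Γ(G, V)) (ht : Ideal.span (Set.range t) = (vanishingIdeal ⟨{x}, hx⟩).ideal V)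
    (hqr : IsQuasiRegular t)
    (f : Γ(G, V)) {m : ℕ} (hm : 0 < m) (P : MvPolynomial (Fin (n + 1)) Γ(G, V)) (hP : P.IsHomogeneous m)
    (hfP : f - MvPolynomial.eval t P ∈ Ideal.span (Set.range t) ^ (m + 1))
    (T : Set G) (hT : ∀ y ∈ T, y ∈ (V : G.Opens) → y ∉ G.basicOpen f) :
    ∃ (k : Type) (_ : Field k) (θ : Γ(G, V) →+* k) (_ : Function.Surjective θ) (_ : ∀ l, θ (t l) = 0)
      (e₀ : Proj (grading (Fin (n + 1)) k) ≅ redSub G' (υ ⁻¹' {x}) (hx.preimage υ.continuous)),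
      ∀ Z : Set G', Z ⊆ υ ⁻¹' {x} ∩ closure (υ ⁻¹' (T \ {x})) →
        (e₀.hom : _ → redSub G' (υ ⁻¹' {x}) (hx.preimage υ.continuous)) ⁻¹'
            ((redSubι G' (υ ⁻¹' {x}) (hx.preimage υ.continuous)) ⁻¹' Z) ⊆
          ProjectiveSpectrum.zeroLocus (grading (Fin (n + 1)) k) {MvPolynomial.map θ P} := by
  obtain ⟨k, hk, θ, hθ, hθt, e₀, h⟩ := exists_iso_freshPlane_tangentCone hx hυ V hxV t ht hqr f hm P hP hfP T hT
  exact ⟨k, hk, θ, hθ, hθt, e₀, fun Z hZ p hp => h (Set.mem_preimage.2 (Set.mem_preimage.2 (hZ hp).2))⟩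

end TangentCone

end Summit.ResolutionOfSingularities.ResolutionOfSingularities.Cruxes.EquisingularLiftNat.Sections

end
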